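import Literature.Probability.RandomPlanarGeometry.ObservableShortTime
import Literature.Probability.RandomPlanarGeometry.LoewnerAdaptedPlane
import Mathlib.MeasureTheory.Function.SpecialFunctions.Basic
import HarnessLib

/-!
# The time-limited FK observable is adapted to the driving process

Topic `Probability/RandomPlanarGeometry`; theorems only. For a real process `W` indexed by `ℝ≥0`
with continuous paths and `y > 0`, the time-limited FK observable process
`Loewner.observableProcess W y t ω = O_{t ∧ y²/9}(iy)`, `O_t(z) = (z g_t'(z)/(g_t(z) - W_t))^{1/2}`
(`ObservableShortTime.lean`), is a measurable functional of the path `W · ω` *up to time `t`*: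
`ω ↦ O_{t ∧ T}(iy)` is measurable for every σ-algebra making `W_s`, `s ≤ t`, measurable
(`Loewner.measurable_observableProcess`). Hence it is (strongly) adapted to every filtration to
which `W` is adapted, in particular to the natural filtration of `W`
(`Loewner.stronglyAdapted_observableProcess_natural`) — the measurability half of the printed
claim "`M_t(z)`, `t ≤ T(z)`, is a martingale with respect to the filtration generated by `W_t`"
(Chelkak–Duminil-Copin–Hongler–Kemppainen–Smirnov, C. R. Math. 352 (2014), §3), serving layer 5
of the decomposition of crit-ising.S17 (FK)
(`Literature.Probability.LatticeModels.convergesInLawToSLE_sixteen_thirds_fkInterface`).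

Ingredients: the tree's `Loewner.measurable_map_of_im_pos` (`LoewnerAdaptedPlane.lean`: `g_t(z)`
is a measurable functional of the stopped path, via truncated Picard iteration), the derivative
`g_t'(z)` as the pointwise limit of measurable difference quotients (`measurable_deriv_map`, the
map being holomorphic at `z` for every path in the short-time regime `9t ≤ (Im z)²`,
`Loewner.ShortTime`), and measurability of the principal power (Mathlib `Measurable.pow_const` on
`ℂ`).

## References

* D. Chelkak, H. Duminil-Copin, C. Hongler, A. Kemppainen, S. Smirnov, *Convergence of Ising
  interfaces to Schramm's SLE curves*, C. R. Math. Acad. Sci. Paris 352 (2014), §3.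
* G. F. Lawler, *Conformally Invariant Processes in the Plane*, AMS (2005), Ch. 4 §4.1.
-/

noncomputable section

open scoped NNReal

namespace Literature.Probability.RandomPlanarGeometry

namespace Loewner

open MeasureTheory Filter Topology Complex

variable {Ω : Type*} {mΩ : MeasurableSpace Ω} {W : ℝ≥0 → Ω → ℝ} {t : ℝ≥0}

/-- **The derivative `g_t'(z)` of the Loewner map is a measurable functional of the driving path
up to time `t`** in the short-time regime `9t ≤ (Im z)²` (where `z` is swallowed for no path):
it is the pointwise limit of the difference quotients `(g_t(z + i/(n+1)) - g_t(z))(n+1)/i`, each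
measurable by `measurable_map_of_im_pos`. [folklore] -/
theorem measurable_deriv_map (hWc : ∀ ω, Continuous (W · ω))
    (hmeas : ∀ s, s ≤ t → Measurable fun ω ↦ W s ω) {z : ℂ} (hz : 0 < z.im)
    (h9 : 9 * (t : ℝ) ≤ z.im ^ 2) :
    Measurable fun ω ↦ deriv (map (fun u ↦ W u ω) t) z := by
  set hs : ℕ → ℂ := fun n ↦ I * ((1 : ℂ) / ((n : ℂ) + 1)) with hhs
  have hn1 : ∀ n : ℕ, ((n : ℂ) + 1) ≠ 0 := fun n ↦ by
    have : ((n : ℂ) + 1) = ((n + 1 : ℕ) : ℂ) := by push_cast; ring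
    rw [this]; exact Nat.cast_ne_zero.2 (Nat.succ_ne_zero n)
  have hne : ∀ n, hs n ≠ 0 := fun n ↦ mul_ne_zero I_ne_zero (div_ne_zero one_ne_zero (hn1 n))
  have hlim : Tendsto hs atTop (𝓝[≠] 0) := by
    refine tendsto_nhdsWithin_iff.2 ⟨?_, Eventually.of_forall hne⟩
    have h1 : Tendsto (fun n : ℕ ↦ (1 : ℂ) / ((n : ℂ) + 1)) atTop (𝓝 0) := by
      have := tendsto_one_div_add_atTop_nhds_zero_nat (𝕜 := ℂ)
      simpa using this
    simpa [hhs] using h1.const_mul I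
  have him : ∀ n, 0 < (z + hs n).im := fun n ↦ by
    have h1 : (hs n).im = 1 / ((n : ℝ) + 1) := by
      have : hs n = ((1 / ((n : ℝ) + 1) : ℝ) : ℂ) * I := by
        simp only [hhs]; push_cast; ring
      rw [this, mul_im, ofReal_re, ofReal_im, I_re, I_im]; ring
    rw [add_im, h1]; positivity
  set G : ℕ → Ω → ℂ := fun n ω ↦ (hs n)⁻¹ • (map (fun u ↦ W u ω) t (z + hs n) - map (fun u ↦ W u ω) t z)
    with hG
  have hmz : Measurable fun ω ↦ map (fun u ↦ W u ω) t z :=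
    measurable_map_of_im_pos (W := fun ω u ↦ W u ω) hWc hmeas hz
  have hGm : ∀ n, Measurable (G n) := fun n ↦
    Measurable.const_smul
      ((measurable_map_of_im_pos (W := fun ω u ↦ W u ω) hWc hmeas (him n)).sub hmz) (hs n)⁻¹
  refine measurable_of_tendsto_metrizable hGm (tendsto_pi_nhds.2 fun ω ↦ ?_)
  have hST : ShortTime (fun u ↦ W u ω) z t := ⟨hWc ω, hz, h9⟩
  obtain ⟨g, hg⟩ := hST.exists_sol
  have hd := hasDerivAt_map hST.cont hST.lt hg
  rw [hd.deriv]
  exact hd.tendsto_slope_zero.comp hlim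

/-- **The FK observable `O_t(iy)` is a measurable functional of the driving path up to time `t`**
(`9t ≤ y²`, `y > 0`). [folklore] -/
theorem measurable_fkObservable (hWc : ∀ ω, Continuous (W · ω))
    (hmeas : ∀ s, s ≤ t → Measurable fun ω ↦ W s ω) {y : ℝ} (hy : 0 < y)
    (h9 : 9 * (t : ℝ) ≤ y ^ 2) :
    Measurable fun ω ↦ fkObservable (fun u ↦ W u ω) t (I * y) := by
  have hz : 0 < (I * (y : ℂ)).im := by simpa using hy
  have h9' : 9 * (t : ℝ) ≤ (I * (y : ℂ)).im ^ 2 := by simpa using h9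
  have hmz : Measurable fun ω ↦ map (fun u ↦ W u ω) t (I * y) :=
    measurable_map_of_im_pos (W := fun ω u ↦ W u ω) hWc hmeas hz
  have hd := measurable_deriv_map hWc hmeas hz h9'
  have hW : Measurable fun ω ↦ ((W t ω : ℝ) : ℂ) := measurable_ofReal.comp (hmeas t le_rfl)
  unfold fkObservable
  exact ((hd.const_mul _).div (hmz.sub hW)).pow_const _

/-- **The time-limited observable process is a measurable functional of the driving path up to
the present**: `ω ↦ O_{t ∧ T(iy)}(iy)` is measurable for any σ-algebra making `W_s`, `s ≤ t`,
measurable. [folklore] -/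
theorem measurable_observableProcess (hWc : ∀ ω, Continuous (W · ω))
    (hmeas : ∀ s, s ≤ t → Measurable fun ω ↦ W s ω) {y : ℝ} (hy : 0 < y) :
    Measurable (observableProcess W y t) := by
  have h9 : 9 * ((min t (cdhksTime y) : ℝ≥0) : ℝ) ≤ y ^ 2 := by
    have h1 : ((min t (cdhksTime y) : ℝ≥0) : ℝ) ≤ (cdhksTime y : ℝ) :=
      NNReal.coe_le_coe.2 (min_le_right _ _)
    rw [coe_cdhksTime] at h1
    linarith
  exact measurable_fkObservable (t := min t (cdhksTime y)) hWc
    (fun s hs ↦ hmeas s (hs.trans (min_le_left _ _))) hy h9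

/-- **The time-limited observable process is adapted** to every filtration to which `W`
(continuous paths) is adapted; likewise its real and imaginary parts. [folklore] -/
theorem stronglyAdapted_observableProcess {𝓕 : Filtration ℝ≥0 mΩ} (hWad : StronglyAdapted 𝓕 W)
    (hWc : ∀ ω, Continuous (W · ω)) {y : ℝ} (hy : 0 < y) :
    StronglyAdapted 𝓕 (observableProcess W y) := fun t ↦
  (measurable_observableProcess (mΩ := 𝓕 t) hWc
    (fun s hs ↦ ((hWad s).mono (𝓕.mono hs)).measurable) hy).stronglyMeasurable

/-- Real part: adaptedness. [folklore] -/
theorem stronglyAdapted_re_observableProcess {𝓕 : Filtration ℝ≥0 mΩ} (hWad : StronglyAdapted 𝓕 W)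
    (hWc : ∀ ω, Continuous (W · ω)) {y : ℝ} (hy : 0 < y) :
    StronglyAdapted 𝓕 (fun t ω ↦ (observableProcess W y t ω).re) := fun t ↦
  (measurable_re.comp (measurable_observableProcess (mΩ := 𝓕 t) hWc
    (fun s hs ↦ ((hWad s).mono (𝓕.mono hs)).measurable) hy)).stronglyMeasurable

/-- Imaginary part: adaptedness. [folklore] -/
theorem stronglyAdapted_im_observableProcess {𝓕 : Filtration ℝ≥0 mΩ} (hWad : StronglyAdapted 𝓕 W)
    (hWc : ∀ ω, Continuous (W · ω)) {y : ℝ} (hy : 0 < y) :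
    StronglyAdapted 𝓕 (fun t ω ↦ (observableProcess W y t ω).im) := fun t ↦
  (measurable_im.comp (measurable_observableProcess (mΩ := 𝓕 t) hWc
    (fun s hs ↦ ((hWad s).mono (𝓕.mono hs)).measurable) hy)).stronglyMeasurable

/-- **Adaptedness to the natural filtration of the driving process** (the filtration "generated by
`W_t`" of CDHKS 2014, §3): the time-limited observable process and its real and imaginary parts
are adapted to `Filtration.natural W`. [cite: CDHKSCRAS2014, §3] -/
theorem stronglyAdapted_observableProcess_natural (hW : ∀ t, StronglyMeasurable (W t))
    (hWc : ∀ ω, Continuous (W · ω)) {y : ℝ} (hy : 0 < y) :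
    StronglyAdapted (Filtration.natural W hW) (observableProcess W y) ∧
    StronglyAdapted (Filtration.natural W hW) (fun t ω ↦ (observableProcess W y t ω).re) ∧
    StronglyAdapted (Filtration.natural W hW) (fun t ω ↦ (observableProcess W y t ω).im) :=
  ⟨stronglyAdapted_observableProcess (Filtration.stronglyAdapted_natural hW) hWc hy,
    stronglyAdapted_re_observableProcess (Filtration.stronglyAdapted_natural hW) hWc hy,
    stronglyAdapted_im_observableProcess (Filtration.stronglyAdapted_natural hW) hWc hy⟩

end Loewner

end Literature.Probability.RandomPlanarGeometry
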